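import Mathlib
import HarnessLib
import Summits.HubbardSuperconductivity.HubbardSuperconductivity.Theorems.KLProgrammeKLRegimeEnginePairLadderSigned
import Summits.HubbardSuperconductivity.HubbardSuperconductivity.Theorems.KLProgrammeKLRegimeSplitEngineV9

/-!
# Route `KLProgramme` — crux K3, the (E2-v9) clause ON THE WICK CARRIERS (`PairLadderStepAtW9`, `…KLRegimeSplitEngineV9` §2, option (B) of
# p1 g8's E2-STRUCTURE, gen-6 material per plan g12 (R14)): the by-name constructor from expansion-level data — `pairLadderStepAtW9_of_expansion`

Cell gate-hubbard-kl, seat hubbard-kl-k3c1-p1 (g4).  Token twins of the plain-carrier bridge: the generic signed step `klpls_signedStepReal`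
(p469901) is carrier-agnostic (any matrix `C` on the momentum carrier), so the Wick version only renames the model objects:
`klpli_wickPairArray_entry_le` (`PairArrayAtW … j ⇒ |𝒞^W_j(Qm)(s,t)| ≤ 2|U| + D·U²` everywhere, twin of `klpli_pairArray_entry_le`),
`klpls_signedStepReal_of_expansion_W` (abstract `E`/`B`, twin of `klpls_signedStepReal_of_expansion`), and
**`pairLadderStepAtW9_of_expansion`** (`E := 2·klEdge`, `B :=` the V9 budget incl. the crossed-channel gains (X); twin of
`pairLadderStepAtV9_of_expansion` p488287).  Bookkeeping only; nothing about the model is asserted.  0 kit.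
-/

noncomputable section

namespace Summit.HubbardSuperconductivity.HubbardSuperconductivity.Theorems.KLRegimeSplit

set_option linter.dupNamespace false -- summit = problem name (single-conjunct summit), D-0017

open Finset Matrix Literature.MathematicalPhysics.QuantumLattice Literature.Probability.LatticeModels
open Summit.HubbardSuperconductivity.HubbardSuperconductivity.Theorems.KLProgrammeCooperResummation
open Summit.HubbardSuperconductivity.HubbardSuperconductivity.Theorems.KLProgrammeLegKernels
open Summit.HubbardSuperconductivity.HubbardSuperconductivity.Theorems.KLRegimeWick

section Model

variable (L M : ℕ) [NeZero L] [NeZero M]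
variable {F : Type*} [Fintype F] [DecidableEq F] [Nonempty F]

/-- **Global entry bound of the truncated Wick pair array from the Wick split slot** (twin of `klpli_pairArray_entry_le`): `PairArrayAtW … j`
gives `|𝒞^W_j(Qm)(s,t)| ≤ 2|U| + D·U²` for ALL `s, t` (`D = P.C_W + klLegKappa·Q.CR·P.Klam³ ≥ 0`; the array vanishes off the ball). -/
theorem klpli_wickPairArray_entry_le {P : SplitConsts} {Q : EngConsts} {β U μ : ℝ} {K : TrigPolyC4v} {j : ℕ}
    (hsplit : PairArrayAtW L M P Q β U μ K j) (hD : 0 ≤ P.C_W + klLegKappa * Q.CR * P.Klam ^ 3) (Qm s t : TorusSite 2 L) :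
    ‖klWickPairArray L M β U μ K j Qm s t‖ ≤ 2 * |U| + (P.C_W + klLegKappa * Q.CR * P.Klam ^ 3) * U ^ 2 := by
  obtain ⟨u, hu0, hu2, hball⟩ := hsplit Qm
  have hδ : 0 ≤ (P.C_W + klLegKappa * Q.CR * P.Klam ^ 3) * U ^ 2 := mul_nonneg hD (sq_nonneg U)
  rw [klWickPairArray_apply]
  split_ifs with hst
  · have h1 := hball s hst.1 t hst.2
    calc ‖klWickPairAmplitude L M β U μ K j Qm s t‖
        = ‖(klWickPairAmplitude L M β U μ K j Qm s t - (u : ℂ)) + (u : ℂ)‖ := by rw [sub_add_cancel]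
      _ ≤ ‖klWickPairAmplitude L M β U μ K j Qm s t - (u : ℂ)‖ + ‖(u : ℂ)‖ := norm_add_le _ _
      _ ≤ (P.C_W + klLegKappa * Q.CR * P.Klam ^ 3) * U ^ 2 + u := by
          rw [Complex.norm_real, Real.norm_eq_abs, abs_of_nonneg hu0]; linarith
      _ ≤ 2 * |U| + (P.C_W + klLegKappa * Q.CR * P.Klam ^ 3) * U ^ 2 := by linarith
  · rw [norm_zero]; positivity

/-- **The signed (E2) step at `1 ≤ n` on the WICK carriers, REAL weights, abstract `E`/`B`** (token twin of
`klpls_signedStepReal_of_expansion`: `klPairArray ↦ klWickPairArray`, `klPairAmplitude ↦ klWickPairAmplitude`). -/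
theorem klpls_signedStepReal_of_expansion_W {G : GeoConsts} {β U μ : ℝ} {K₀ : TrigPolyC4v} {n : ℕ} (a₀ : F) {m : ℝ}
    (E : TorusSite 2 L → ℝ) (B : TorusSite 2 L → TorusSite 2 L → TorusSite 2 L → ℝ)
    (hm : 0 ≤ m) (hC : ∀ Qm s t, ‖klWickPairArray L M β U μ K₀ (n - 1) Qm s t‖ ≤ m) (hsmall : G.bhi * m ≤ 1 / 3)
    (hexp : ∀ Qm : TorusSite 2 L, IsPairClassAt L Qm n →
      ∃ (K : Matrix (TorusSite 2 L × F) (TorusSite 2 L × F) ℂ) (z' : TorusSite 2 L × F → ℂ)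
        (TK : Matrix (TorusSite 2 L × F) (TorusSite 2 L × F) ℂ) (m' : ℝ),
        0 ≤ m' ∧ (∀ x y, ‖K x y‖ ≤ m') ∧ m' * ∑ x, ‖z' x‖ ≤ 1 / 3 ∧ ∑ x, ‖z' x‖ ≤ G.bhi ∧
        (∑ p, ‖∑ b, z' (p, b)‖) - (∑ p, ∑ b, z' (p, b)).re ≤ E Qm ∧ (∀ p, (∑ b, z' (p, b)).im = 0) ∧
        HasSum (fun j : ℕ => K * (-(Matrix.diagonal z' * K)) ^ j) TK ∧
        ∀ k ∈ klBall L μ K₀, ∀ k' ∈ klBall L μ K₀,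
          ‖klWickPairAmplitude L M β U μ K₀ n Qm k k' - TK (k, a₀) (k', a₀)‖ +
            (‖K (k, a₀) (k', a₀) - klWickPairArray L M β U μ K₀ (n - 1) Qm k k'‖ +
              3 / 2 * m * ∑ b, ‖K (k, a₀) b - klWickPairArray L M β U μ K₀ (n - 1) Qm k b.1‖ * ‖z' b‖ +
              3 / 2 * m' * ∑ a, ‖z' a‖ * ‖K a (k', a₀) - klWickPairArray L M β U μ K₀ (n - 1) Qm a.1 k'‖ +
              9 / 4 * m' * m * ∑ a, ∑ b, ‖z' a‖ * ‖K a b - klWickPairArray L M β U μ K₀ (n - 1) Qm a.1 b.1‖ * ‖z' b‖) ≤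
          B Qm k k') :
    ∀ Qm : TorusSite 2 L, IsPairClassAt L Qm n →
      ∃ w : TorusSite 2 L → ℝ, (∑ p, |w p| ≤ G.bhi) ∧ (∑ p, (|w p| - w p) ≤ E Qm) ∧ (-E Qm ≤ ∑ p, w p) ∧
        ∃ N : Matrix (TorusSite 2 L) (TorusSite 2 L) ℂ,
          (1 + Matrix.diagonal (fun p => (w p : ℂ)) * klWickPairArray L M β U μ K₀ (n - 1) Qm) * N = 1 ∧
          N * (1 + Matrix.diagonal (fun p => (w p : ℂ)) * klWickPairArray L M β U μ K₀ (n - 1) Qm) = 1 ∧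
          ∀ k ∈ klBall L μ K₀, ∀ k' ∈ klBall L μ K₀,
            ‖klWickPairAmplitude L M β U μ K₀ n Qm k k' - (klWickPairArray L M β U μ K₀ (n - 1) Qm * N) k k'‖ ≤ B Qm k k' := by
  intro Qm hQm
  obtain ⟨K, z', TK, m', hm', hK, hzK, hzsum, hmass, hreal, hTK, hacc⟩ := hexp Qm hQm
  have hzC : m * ∑ x, ‖z' x‖ ≤ 1 / 3 :=
    calc m * ∑ x, ‖z' x‖ ≤ m * G.bhi := mul_le_mul_of_nonneg_left hzsum hm
      _ = G.bhi * m := mul_comm _ _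
      _ ≤ 1 / 3 := hsmall
  obtain ⟨w, -, hb, hE, hnet, N, hN1, hN2, -, hbd⟩ :=
    klpls_signedStepReal (klWickPairArray L M β U μ K₀ (n - 1) Qm) K z' hm hm' (hC Qm) hK hzC hzK hzsum hmass hreal TK hTK
  refine ⟨w, hb, hE, hnet, N, hN1, hN2, fun k hk k' hk' => ?_⟩
  have h1 := hacc k hk k' hk'
  have h2 := hbd (k, a₀) (k', a₀)
  calc ‖klWickPairAmplitude L M β U μ K₀ n Qm k k' - (klWickPairArray L M β U μ K₀ (n - 1) Qm * N) k k'‖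
      = ‖(klWickPairAmplitude L M β U μ K₀ n Qm k k' - TK (k, a₀) (k', a₀)) +
          (TK (k, a₀) (k', a₀) - (klWickPairArray L M β U μ K₀ (n - 1) Qm * N) k k')‖ := by rw [sub_add_sub_cancel]
    _ ≤ ‖klWickPairAmplitude L M β U μ K₀ n Qm k k' - TK (k, a₀) (k', a₀)‖ +
          ‖TK (k, a₀) (k', a₀) - (klWickPairArray L M β U μ K₀ (n - 1) Qm * N) k k'‖ := norm_add_le _ _
    _ ≤ B Qm k k' := by linarith

/-- **(E2-W9) `PairLadderStepAtW9` at `1 ≤ n` BY NAME from expansion-level data on the Wick carriers** (twin of `pairLadderStepAtV9_of_expansion`):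
from the Wick split slot `PairArrayAtW … (n−1)` of the history, the package smallness, and per pair class the rung `K`, the FULL step weights
`z′` ((m)/(neg)/(real)), the `K`-ladder sum and ONE weighted accounting line against the V9 budget incl. the crossed-channel gains (X). -/
theorem pairLadderStepAtW9_of_expansion {G : GeoConsts} {P : SplitConsts} {Q : EngConsts} {β U μ : ℝ} {K₀ : TrigPolyC4v} {n : ℕ}
    (a₀ : F) (hn : 1 ≤ n)
    (hsplit : PairArrayAtW L M P Q β U μ K₀ (n - 1)) (hD : 0 ≤ P.C_W + klLegKappa * Q.CR * P.Klam ^ 3)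
    (hsmall : G.bhi * (2 * |U| + (P.C_W + klLegKappa * Q.CR * P.Klam ^ 3) * U ^ 2) ≤ 1 / 3)
    (hexp : ∀ Qm : TorusSite 2 L, IsPairClassAt L Qm n →
      ∃ (K : Matrix (TorusSite 2 L × F) (TorusSite 2 L × F) ℂ) (z' : TorusSite 2 L × F → ℂ)
        (TK : Matrix (TorusSite 2 L × F) (TorusSite 2 L × F) ℂ) (m' : ℝ),
        0 ≤ m' ∧ (∀ x y, ‖K x y‖ ≤ m') ∧ m' * ∑ x, ‖z' x‖ ≤ 1 / 3 ∧ ∑ x, ‖z' x‖ ≤ G.bhi ∧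
        (∑ p, ‖∑ b, z' (p, b)‖) - (∑ p, ∑ b, z' (p, b)).re ≤ 2 * klEdge G n (klTorusNorm L Qm) ∧ (∀ p, (∑ b, z' (p, b)).im = 0) ∧
        HasSum (fun j : ℕ => K * (-(Matrix.diagonal z' * K)) ^ j) TK ∧
        ∀ k ∈ klBall L μ K₀, ∀ k' ∈ klBall L μ K₀,
          ‖klWickPairAmplitude L M β U μ K₀ n Qm k k' - TK (k, a₀) (k', a₀)‖ +
            (‖K (k, a₀) (k', a₀) - klWickPairArray L M β U μ K₀ (n - 1) Qm k k'‖ +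
              3 / 2 * (2 * |U| + (P.C_W + klLegKappa * Q.CR * P.Klam ^ 3) * U ^ 2) *
                ∑ b, ‖K (k, a₀) b - klWickPairArray L M β U μ K₀ (n - 1) Qm k b.1‖ * ‖z' b‖ +
              3 / 2 * m' * ∑ a, ‖z' a‖ * ‖K a (k', a₀) - klWickPairArray L M β U μ K₀ (n - 1) Qm a.1 k'‖ +
              9 / 4 * m' * (2 * |U| + (P.C_W + klLegKappa * Q.CR * P.Klam ^ 3) * U ^ 2) *
                ∑ a, ∑ b, ‖z' a‖ * ‖K a b - klWickPairArray L M β U μ K₀ (n - 1) Qm a.1 b.1‖ * ‖z' b‖) ≤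
          drivePBar G P U (n - 1) + eremBar G P Q U β L (n - 1) + thermalBar G P U β n +
            legDressBarQ G P Q U n (legSliceCountT L β μ K₀ n ![k', Qm - k', Qm - k, k]) +
            (P.Klam * U) ^ 2 * (G.phGain n (klTorusNorm L (k - k')) + G.phGain n (klTorusNorm L (k + k' - Qm)))) :
    PairLadderStepAtW9 L M G P Q β U μ K₀ n := by
  have hm : 0 ≤ 2 * |U| + (P.C_W + klLegKappa * Q.CR * P.Klam ^ 3) * U ^ 2 := by
    have : 0 ≤ (P.C_W + klLegKappa * Q.CR * P.Klam ^ 3) * U ^ 2 := mul_nonneg hD (sq_nonneg U)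
    have : 0 ≤ |U| := abs_nonneg U
    linarith
  refine ⟨fun h0 => absurd h0 (by omega), fun _ Qm hQm => ?_⟩
  obtain ⟨w, hb, hE, -, N, hN1, -, hbd⟩ := klpls_signedStepReal_of_expansion_W L M a₀
    (fun Qm => 2 * klEdge G n (klTorusNorm L Qm))
    (fun Qm k k' => drivePBar G P U (n - 1) + eremBar G P Q U β L (n - 1) + thermalBar G P U β n +
      legDressBarQ G P Q U n (legSliceCountT L β μ K₀ n ![k', Qm - k', Qm - k, k]) +
      (P.Klam * U) ^ 2 * (G.phGain n (klTorusNorm L (k - k')) + G.phGain n (klTorusNorm L (k + k' - Qm))))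
    hm (fun Qm s t => klpli_wickPairArray_entry_le L M hsplit hD Qm s t) hsmall hexp Qm hQm
  exact ⟨w, hb, hE, N, hN1, hbd⟩

end Model

end Summit.HubbardSuperconductivity.HubbardSuperconductivity.Theorems.KLRegimeSplit

end
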